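import Literature.Barriers.QuantumAdvantage.PPolyOraclesThm76QuantumTables
import HarnessLib

/-!
# Aaronson–Chen 2017, Lemma 7.5 (2)–(3): the two probability bounds of the read-out

Companion of `PPolyOraclesThm76.lean` towards the discharge of `aaronsonChen2017_lem75_quantum`
(S. Aaronson, L. Chen, CCC 2017, arXiv:1612.05903, App. 13 p. 42). The decision event of the
distinguisher on the structured read-out `γ` of its quantum core (`family_law`,
`PeriodFindingFamily.lean`): **`Found`** — at some candidate length two distinct units return the
same continued-fraction candidate `≥ 2` (the verification-free two-hit form of "apply the
period-finding algorithm polynomially many times", App. 13). Its probability under the product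
law `prob (unitLaw …)`:

* `prob_found_le` — at most `1/4` when every unit's answer table is injective on `[0, 2^{L_u})`
  ("`f` is a permutation … accepts with probability `0`", App. 13; the residual `1/4` is the
  read-out's own error: false candidates of injective tables, `unitLaw_candidate_le`, over the
  `12² · nL` ordered pairs, `prob_collision_le`);
* `prob_found_ge` — at least `2/3` when the twelve units of one length have a periodic table of
  prime period `5 ≤ a < √Q / 1` with an injective period pattern (each detects `a` with
  probability `≥ 0.26`, `unitLaw_detect_ge`; two halves of six, `prob_twoHalves_ge`) ("`f = g_{mod a}`
  … we can find `a`", App. 13, via Shor 1997 §5 / Boneh–Lipton 1995).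

## References

* [AaronsonChen2017] arXiv:1612.05903, Lemma 7.5 (p. 30), App. 13 (p. 42).
* [Shor1997] SIAM J. Comput. 26 (1997), §5.   * [BonehLipton1995] CRYPTO '95, LNCS 963.
* [Kitaev1995] arXiv:quant-ph/9511026, §3 Thm 1.
-/

noncomputable section

namespace Literature.Barriers.QuantumAdvantage

open _root_.Computability Literature.Computability.Complexity Literature.Computability.Cryptography
  Literature.Computability.Cryptography.PeriodFinding Literature.Computability.Cryptography.Kitaev1995
  Literature.Computability.Cryptography.Shor1997 Finset

variable (P : FParams) (n : ℕ)

/-! ### The events -/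

/-- Shor's search bound of unit `u`: `⌊√Q_u⌋`. [cite: Shor1997, §5] -/
def nSof (u : Fin (nU P n)) : ℕ := Nat.sqrt (Qof (spec P n).L u)

/-- The candidate period read off unit `u`. [cite: Shor1997, §5] -/
def cand (u : Fin (nU P n)) (γu : TIdx (Lv P n) (Bn P n) → Bool) : ℕ := candOf (spec P n).L (nSof P n) u γu

/-- The twelve units probing the length of index `λi`. [folklore] -/
def unitsOf (li : Fin (nL P n)) : Finset (Fin (nU P n)) := univ.filter fun u => (eU P n u).1 = li

/-- The two halves of six. [folklore] -/
def halfOf (li : Fin (nL P n)) (b : Fin 2) : Finset (Fin (nU P n)) :=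
  univ.filter fun u => (eU P n u).1 = li ∧ (eU P n u).2.1 = b

/-- **A period is found at length index `λi`**: two distinct units of that length return the same
candidate `≥ 2`. [cite: AaronsonChen2017, App. 13 (proof of Lemma 7.5)] -/
def FoundAt (li : Fin (nL P n)) (γ : Readout P n) : Prop :=
  ∃ u ∈ unitsOf P n li, ∃ u' ∈ unitsOf P n li, u ≠ u' ∧ cand P n u (γ u) = cand P n u' (γ u') ∧ 2 ≤ cand P n u (γ u)

/-- **A period is found.** [cite: AaronsonChen2017, App. 13 (proof of Lemma 7.5)] -/
def Found (γ : Readout P n) : Prop := ∃ li, FoundAt P n li γ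

/-- `FoundAt` is decidable (finite search). [folklore] -/
instance instDecidablePredFoundAt (li : Fin (nL P n)) : DecidablePred (FoundAt P n li) := fun _ => by
  unfold FoundAt; infer_instance

/-- `Found` is decidable (finite search). [folklore] -/
instance instDecidablePredFound : DecidablePred (Found P n) := fun _ => by
  unfold Found; infer_instance

/-- The read-out law of the quantum core relative to `A` (see `family_law`). [folklore] -/
def lawOf (A : Language Bool) : (u : Fin (nU P n)) → (TIdx (Lv P n) (Bn P n) → Bool) → ℝ :=
  unitLaw (spec P n).L (Fu (spec P n) A)

/-- It is a product of probability vectors. [folklore] -/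
theorem lawOf_isProbVec (A : Language Bool) :
    IsProbVec (X := fun _ : Fin (nU P n) => TIdx (Lv P n) (Bn P n) → Bool) (lawOf P n A) :=
  unitLaw_isProbVec _ _

/-! ### Numerics of the parameters -/

/-- The block length of a unit of length index `λi`. [folklore] -/
theorem Lof_eq_of_mem {li : Fin (nL P n)} {u : Fin (nU P n)} (hu : u ∈ unitsOf P n li) : Lof P n u = n + li := by
  simp only [unitsOf, mem_filter, mem_univ, true_and] at hu
  simp [Lof, hu]

/-- Twelve units per length. [folklore] -/
theorem card_unitsOf (li : Fin (nL P n)) : (unitsOf P n li).card = 12 := by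
  have h : unitsOf P n li = (univ : Finset (Fin 2 × Fin 6)).map
      ⟨fun b => (eU P n).symm (li, b), fun b b' e => by simpa using congrArg (eU P n) e⟩ := by
    ext u
    simp only [unitsOf, mem_filter, mem_univ, true_and, mem_map, Function.Embedding.coeFn_mk]
    constructor
    · intro hu
      exact ⟨(eU P n u).2, by rw [← hu, Prod.mk.eta, Equiv.symm_apply_apply]⟩
    · rintro ⟨b, rfl⟩
      simp
  rw [h, card_map]
  simp

/-- Six units per half. [folklore] -/
theorem card_halfOf (li : Fin (nL P n)) (b : Fin 2) : (halfOf P n li b).card = 6 := by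
  have h : halfOf P n li b = (univ : Finset (Fin 6)).map
      ⟨fun t => (eU P n).symm (li, (b, t)), fun t t' e => by simpa using congrArg (eU P n) e⟩ := by
    ext u
    simp only [halfOf, mem_filter, mem_univ, true_and, mem_map, Function.Embedding.coeFn_mk]
    constructor
    · rintro ⟨hu, hb⟩
      exact ⟨(eU P n u).2.2, by rw [← hu, ← hb]; simp⟩
    · rintro ⟨t, rfl⟩
      simp
  rw [h, card_map]
  simp

/-- Halves consist of units of that length. [folklore] -/
theorem halfOf_subset (li : Fin (nL P n)) (b : Fin 2) : halfOf P n li b ⊆ unitsOf P n li := by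
  intro u hu
  simp only [halfOf, unitsOf, mem_filter, mem_univ, true_and] at hu ⊢
  exact hu.1

/-- The accuracy defect of the family: `η = 1/(1152 · nL)`. [cite: Kitaev1995, §3 (before Lemma 9)] -/
theorem ηacc_eq : ηacc (Lv P n) (Bn P n) = 1 / (1152 * nL P n) := by
  have hL : (0 : ℝ) < Lv P n := by exact_mod_cast Lv_pos P n
  have hN : (0 : ℝ) < nL P n := by exact_mod_cast nL_pos P n
  rw [ηacc, Bn]
  push_cast
  field_simp
  ring

/-- Numeric size of `η`. [folklore] -/
theorem ηacc_le : ηacc (Lv P n) (Bn P n) ≤ 1 / 1152 := by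
  rw [ηacc_eq]
  have hN : (1 : ℝ) ≤ nL P n := by exact_mod_cast nL_pos P n
  exact one_div_le_one_div_of_le (by norm_num) (by nlinarith)

/-- `η ≥ 0`. [folklore] -/
theorem ηacc_nonneg' : 0 ≤ ηacc (Lv P n) (Bn P n) := by
  unfold ηacc; positivity

/-- `Q_u ≤ 2^{Lv − 1}` (the levels cover every candidate length). [cite: Kitaev1995, §3 Thm 1] -/
theorem Qof_le_Lv (u : Fin (nU P n)) : Qof (spec P n).L u ≤ 2 ^ (Lv P n - 1) := by
  rw [Qof]
  apply Nat.pow_le_pow_right (by norm_num)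
  show Lof P n u ≤ Lv P n - 1
  have := Lof_lt_Ltop P n u
  unfold Ltop at this
  unfold Lv
  omega

/-- A nonzero candidate is below the search bound. [cite: Shor1997, §5] -/
theorem candidate_lt {m q : ℕ} {ξ : ℝ} (h : candidate m q ξ ≠ 0) : candidate m q ξ < m := by
  classical
  by_cases hex : ∃ r', IsCandidate m q ξ r'
  · have e : candidate m q ξ = Nat.find hex := by
      rw [candidate, dif_pos hex]
    rw [e]
    exact (Nat.find_spec hex).2.1
  · exact absurd (by rw [candidate, dif_neg hex]) h

/-- The search bounds dominate `⌊√(2ⁿ)⌋`. [folklore] -/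
theorem sqrt_le_nSof (u : Fin (nU P n)) : Nat.sqrt (2 ^ n) ≤ nSof P n u := by
  unfold nSof Qof
  exact Nat.sqrt_le_sqrt (Nat.pow_le_pow_right (by norm_num) (by show n ≤ Lof P n u; unfold Lof; omega))

/-! ### The permutation case -/

/-- **False candidates are rare on injective tables**: `P(V_u = v) ≤ η + 2/⌊√(2ⁿ)⌋` for `v ≥ 2`.
[cite: Kitaev1995, §3 Thm 1] [cite: Shor1997, §5] -/
theorem prob_cand_eq_le (A : Language Bool) (u : Fin (nU P n))
    (hinj : Set.InjOn (Fu (spec P n) A u) (range (Qof (spec P n).L u) : Set ℕ)) {v : ℕ} (hv : 2 ≤ v) :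
    ∑ γu ∈ univ.filter (fun γu : TIdx (Lv P n) (Bn P n) → Bool => cand P n u γu = v), lawOf P n A u γu ≤
      ηacc (Lv P n) (Bn P n) + 2 / Nat.sqrt (2 ^ n) := by
  have hQ := Qof_pos (spec P n).L u
  have hs0 : 0 < Nat.sqrt (2 ^ n) := Nat.sqrt_pos.2 (Nat.two_pow_pos n)
  by_cases hvS : v < nSof P n u
  · -- a genuine candidate value: Kitaev + counting
    have hvQ : v < 2 * Qof (spec P n).L u := by
      have : nSof P n u ≤ Qof (spec P n).L u := Nat.sqrt_le_self _
      omega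
    refine (unitLaw_candidate_le (spec P n).L (Fu (spec P n) A) (nSof P n) (Bn_pos P n) (Lv_pos P n)
      (Qof_le_Lv P n u) hinj (by omega) hvQ).trans ?_
    gcongr ?_ + ?_
    · exact le_rfl
    · -- `2 (v + 1) / Q ≤ 2 nS / Q ≤ 2 / nS ≤ 2 / ⌊√(2ⁿ)⌋`
      have hS := sqrt_le_nSof P n u
      have hSS : nSof P n u * nSof P n u ≤ Qof (spec P n).L u := Nat.sqrt_le _
      have hSr : (0 : ℝ) < nSof P n u := by exact_mod_cast lt_of_lt_of_le hs0 hS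
      rw [div_le_div_iff₀ (by exact_mod_cast hQ) (by exact_mod_cast hs0)]
      have h1 : ((v + 1 : ℕ) : ℝ) ≤ nSof P n u := by exact_mod_cast hvS
      have h2 : ((Nat.sqrt (2 ^ n) : ℕ) : ℝ) * nSof P n u ≤ Qof (spec P n).L u := by
        have : ((nSof P n u * nSof P n u : ℕ) : ℝ) ≤ Qof (spec P n).L u := by exact_mod_cast hSS
        push_cast at this
        have hS' : ((Nat.sqrt (2 ^ n) : ℕ) : ℝ) ≤ nSof P n u := by exact_mod_cast hS
        nlinarith
      push_cast at h1 ⊢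
      nlinarith
  · -- no read-out has such a candidate
    have hempty : (univ.filter fun γu : TIdx (Lv P n) (Bn P n) → Bool => cand P n u γu = v) = ∅ := by
      refine filter_eq_empty_iff.2 fun γu _ h => hvS ?_
      rw [← h]
      exact candidate_lt (by unfold cand candOf at h; rw [h]; omega)
    rw [hempty, sum_empty]
    have := ηacc_nonneg' P n
    positivity

/-- **The permutation case**: if every unit's table is injective on `[0, 2^{L_u})` and
`4608 · nL ≤ ⌊√(2ⁿ)⌋`, a period is found with probability at most `1/4`.
[cite: AaronsonChen2017, App. 13 (proof of Lemma 7.5 (3))] -/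
theorem prob_found_le (A : Language Bool)
    (hinj : ∀ u, Set.InjOn (Fu (spec P n) A u) (range (Qof (spec P n).L u) : Set ℕ))
    (hbig : 4608 * nL P n ≤ Nat.sqrt (2 ^ n)) :
    prob (lawOf P n A) (univ.filter (Found P n)) ≤ 1 / 4 := by
  have hμ := lawOf_isProbVec P n A
  have hs0 : 0 < Nat.sqrt (2 ^ n) := Nat.sqrt_pos.2 (Nat.two_pow_pos n)
  -- union over the lengths
  have hU : (univ.filter (Found P n) : Finset (Readout P n)) =
      (univ : Finset (Fin (nL P n))).biUnion fun li => univ.filter (FoundAt P n li) := by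
    ext γ; simp [Found]
  rw [hU]
  refine (prob_biUnion_le hμ _ _).trans ?_
  -- each length: the collision bound
  have hlen : ∀ li : Fin (nL P n), prob (lawOf P n A) (univ.filter (FoundAt P n li)) ≤
      (12 : ℝ) ^ 2 * (ηacc (Lv P n) (Bn P n) + 2 / Nat.sqrt (2 ^ n)) := by
    intro li
    have h := prob_collision_le hμ (unitsOf P n li) (fun u γu => cand P n u γu)
      (ε := ηacc (Lv P n) (Bn P n) + 2 / Nat.sqrt (2 ^ n))
      (fun u _ v hv => prob_cand_eq_le P n A u (hinj u) hv)
    rw [card_unitsOf] at h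
    exact_mod_cast h
  refine (sum_le_sum fun li _ => hlen li).trans ?_
  rw [sum_const, card_univ, Fintype.card_fin, nsmul_eq_mul, ηacc_eq]
  -- `nL · 144 · (1/(1152 nL) + 2/s) ≤ 1/8 + 288 nL / s ≤ 1/8 + 1/16`
  have hN : (0 : ℝ) < nL P n := by exact_mod_cast nL_pos P n
  have hs : (0 : ℝ) < Nat.sqrt (2 ^ n) := by exact_mod_cast hs0
  have hbig' : (4608 : ℝ) * nL P n ≤ Nat.sqrt (2 ^ n) := by exact_mod_cast hbig
  rw [show (nL P n : ℝ) * ((12 : ℝ) ^ 2 * (1 / (1152 * nL P n) + 2 / Nat.sqrt (2 ^ n))) =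
    1 / 8 + 288 * nL P n / Nat.sqrt (2 ^ n) by field_simp; ring]
  have : 288 * (nL P n : ℝ) / Nat.sqrt (2 ^ n) ≤ 1 / 16 := by
    rw [div_le_div_iff₀ hs (by norm_num)]
    nlinarith
  linarith

/-! ### The `PRF^mod` case -/

/-- **A periodic table of prime period is detected by each of its units with probability
`≥ 0.26`.** [cite: Shor1997, §5] [cite: Kitaev1995, §3 Thm 1] -/
theorem prob_cand_eq_ge (A : Language Bool) {li : Fin (nL P n)} {u : Fin (nU P n)} (hu : u ∈ unitsOf P n li)
    {a : ℕ} (ha : a.Prime) (ha5 : 5 ≤ a) (g : ℕ → List Bool) (hg : Set.InjOn g (range a : Set ℕ))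
    (hper : ∀ v < Qof (spec P n).L u, Fu (spec P n) A u v = g (v % a))
    (hthr : shorThreshold ≤ Nat.sqrt (2 ^ (n + li))) (h3 : 3 ≤ Nat.sqrt (2 ^ (n + li)))
    (haS : a < Nat.sqrt (2 ^ (n + li))) :
    (26 : ℝ) / 100 ≤ ∑ γu ∈ univ.filter (fun γu : TIdx (Lv P n) (Bn P n) → Bool => cand P n u γu = a),
      lawOf P n A u γu := by
  have hL : Lof P n u = n + li := Lof_eq_of_mem P n hu
  have hQ : Qof (spec P n).L u = 2 ^ (n + li) := by rw [Qof]; exact congrArg _ hL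
  have hS : nSof P n u = Nat.sqrt (2 ^ (n + li)) := by rw [nSof, hQ]
  -- the idealised table, periodic everywhere, has the same unit law
  let F' : Fin (nU P n) → ℕ → List Bool := fun u' v => if u' = u then g (v % a) else Fu (spec P n) A u' v
  have hF'u : ∀ v, F' u v = g (v % a) := fun v => by
    show (if u = u then g (v % a) else Fu (spec P n) A u v) = g (v % a)
    rw [if_pos rfl]
  have hcongr : unitLaw (Lv := Lv P n) (B := Bn P n) (spec P n).L (Fu (spec P n) A) u = unitLaw (spec P n).L F' u :=
    unitLaw_congr (spec P n).L fun v hv => by rw [hF'u, hper v hv]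
  have hdet := unitLaw_detect_ge (spec P n).L F' (nSof P n) (Bn_pos P n) (Lv_pos P n) (u := u)
    (Qof_le_Lv P n u) (by rwa [hS]) (by rw [nSof]; exact Nat.sqrt_le' _)
    (by
      rw [hS, hQ]
      have h1 := Nat.lt_succ_sqrt' (2 ^ (n + li))
      have h2 : (Nat.sqrt (2 ^ (n + li)) + 1) ^ 2 ≤ 2 * Nat.sqrt (2 ^ (n + li)) ^ 2 := by nlinarith
      exact lt_of_lt_of_le h1 h2)
    (by omega) (by rwa [hS]) g hg hF'u
  rw [show lawOf P n A u = unitLaw (spec P n).L F' u from hcongr]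
  refine le_trans ?_ hdet
  -- `(1 − η) φ(a)/(3a) ≥ (1151/1152) (4/5) / 3 ≥ 0.26`
  rw [Nat.totient_prime ha]
  have hη := ηacc_le P n
  have hη0 := ηacc_nonneg' P n
  have ha' : (5 : ℝ) ≤ a := by exact_mod_cast ha5
  have hφ : (4 : ℝ) / 5 ≤ ((a - 1 : ℕ) : ℝ) / a := by
    rw [Nat.cast_sub (by omega), le_div_iff₀ (by linarith)]
    push_cast
    nlinarith
  calc (26 : ℝ) / 100 ≤ (1 - 1 / 1152) * ((4 / 5) / 3) := by norm_num
    _ ≤ (1 - ηacc (Lv P n) (Bn P n)) * (((a - 1 : ℕ) : ℝ) / a / 3) := by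
        apply mul_le_mul (by linarith) (by linarith) (by norm_num) (by linarith)
    _ = (1 - ηacc (Lv P n) (Bn P n)) * (((a - 1 : ℕ) : ℝ) / (3 * a)) := by ring

/-- **The `PRF^mod` case**: if the twelve units of one length have a periodic table of prime
period `a ≥ 5` below `⌊√Q⌋` with an injective period pattern (and `⌊√Q⌋` is above Shor's
threshold), a period is found with probability at least `2/3`.
[cite: AaronsonChen2017, App. 13 (proof of Lemma 7.5 (2))] -/
theorem prob_found_ge (A : Language Bool) (li : Fin (nL P n)) {a : ℕ} (ha : a.Prime) (ha5 : 5 ≤ a)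
    (g : ℕ → List Bool) (hg : Set.InjOn g (range a : Set ℕ))
    (hper : ∀ u ∈ unitsOf P n li, ∀ v < Qof (spec P n).L u, Fu (spec P n) A u v = g (v % a))
    (hthr : shorThreshold ≤ Nat.sqrt (2 ^ (n + li))) (h3 : 3 ≤ Nat.sqrt (2 ^ (n + li)))
    (haS : a < Nat.sqrt (2 ^ (n + li))) :
    (2 : ℝ) / 3 ≤ prob (lawOf P n A) (univ.filter (Found P n)) := by
  have hμ := lawOf_isProbVec P n A
  have hp : ∀ b : Fin 2, ∀ u ∈ halfOf P n li b, (26 : ℝ) / 100 ≤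
      ∑ x ∈ univ.filter (fun γu : TIdx (Lv P n) (Bn P n) → Bool => cand P n u γu = a), lawOf P n A u x :=
    fun b u hu => prob_cand_eq_ge P n A (halfOf_subset P n li b hu) ha ha5 g hg
      (hper u (halfOf_subset P n li b hu)) hthr h3 haS
  have h := prob_twoHalves_ge hμ (halfOf P n li 0) (halfOf P n li 1)
    (fun u => univ.filter fun γu : TIdx (Lv P n) (Bn P n) → Bool => cand P n u γu = a) (hp 0) (hp 1)
  rw [card_halfOf, card_halfOf] at h
  refine le_trans (le_trans (by norm_num) h) (prob_mono hμ fun γ hγ => ?_)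
  -- two halves detecting `a` give a two-hit
  simp only [mem_inter, mem_filter, mem_univ, true_and] at hγ
  obtain ⟨⟨u, hu, hcu⟩, ⟨u', hu', hcu'⟩⟩ := hγ
  rw [mem_filter]
  refine ⟨mem_univ _, li, u, halfOf_subset P n li 0 hu, u', halfOf_subset P n li 1 hu', fun e => ?_,
    by rw [hcu, hcu'], by rw [hcu]; omega⟩
  subst e
  simp only [halfOf, mem_filter, mem_univ, true_and] at hu hu'
  have h01 : (0 : Fin 2) = 1 := hu.2.symm.trans hu'.2
  exact absurd h01 (by decide)

end Literature.Barriers.QuantumAdvantage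

end
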